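import Summits.Ventures.HodgeRepro2.T5InertDegreeCount
import Summits.Ventures.HodgeRepro2.T5InertTraceLift
import Summits.Ventures.HodgeRepro2.T5InertStructureConstants

/-!
# `deg Tₙ = (q³ + 1) q^{4n−3}` and the tree recursion of `H(U(2,1), K)` without degree hypotheses
(cell pub-hodge-repro2, seat p3)

Tier-5 N3 support — THE CLOSE OF T5-SATAKE-KERNEL-p3.md ROW 11. With `q = #{t ∈ 𝔽 : t + t̄ = 0}` and the
residue involution non-trivial (`#𝔽 = q²`, file 202), the count of file 201 reads as printed:

* **`ncard_orbit_cellU_eq_printed`** — `deg Tₙ = #(K aₙ K / K) = (q³ + 1) q^{4n−3}` for `n ≥ 1`;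
* `ncard_orbit_cellU_zero` (`deg T₀ = 1`), `ncard_orbit_cellU_one_printed` (`deg T₁ = q⁴ + q`),
  **`ncard_orbit_cellU_succ_printed`** (`deg T_{n+1} = q⁴ · deg Tₙ`, `n ≥ 1`), `ncard_orbit_cellU_pos`;
* **`mul_cellU_eq`** / **`mul_cellU_one_eq`** — file 192's tree recursion with its three degree hypotheses
  DISCHARGED: over any field `k` of characteristic `0`, with `q = (#{trace zero} : k)`,
  `T₁ · T_{n+1} = T_{n+2} + (q − 1) T_{n+1} + q⁴ Tₙ` (`n ≥ 1`) and `T₁² = T₂ + (q − 1) T₁ + (q⁴ + q) T₀`;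
* **`ncard_orbit_cellU_eq_inert`**, **`mul_cellU_eq_inert`**, **`mul_cellU_one_eq_inert`** — the same from the
  non-triviality of the residue involution ALONE (file 204 supplies the trace lift).

Hypotheses: p8's standing ones (`R` a DVR with finite residue field, `E = Frac R`, the integrality-preserving
involution, the star-fixed unit `u`, the uniformiser `ϖ` with star-fixed image), the trace lift
`htr : ∃ e ∈ R, e + ē = 1` and the non-triviality of the residue involution
`hnt : ∃ x ∈ R, x − x̄ ∉ ϖ R` — the two features of an inert place (p8's T5-170: `σ̄ = Frob`); the last three
theorems need `hnt` only.

Mathlib + this seat's files 192 / 201 / 202 / 204 and their imports; no display; no device.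
§8(d): uses an L-value-free non-vanishing device: NO.
-/

namespace Summit.Ventures.HodgeRepro2.T5InertDegreePrinted

open Summit.Ventures.HodgeRepro2.T5HermitianThreeElements Summit.Ventures.HodgeRepro2.T5UnitaryGroupForm
  Summit.Ventures.HodgeRepro2.T5UnitaryHeckeAdjoint Summit.Ventures.HodgeRepro2.T5HeckeBasisCells
  Summit.Ventures.HodgeRepro2.T5HeckeDegreeIndex Summit.Ventures.HodgeRepro2.T5CartanCellsDistinct
  Summit.Ventures.HodgeRepro2.T5InertTopCoefficientMatrix Summit.Ventures.HodgeRepro2.T5InertTopCoefficient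
  Summit.Ventures.HodgeRepro2.T5InertUnipotentResidue
  Summit.Ventures.HodgeRepro2.T5InertDegreeCount Summit.Ventures.HodgeRepro2.T5InertResidueInvolution
  Summit.Ventures.HodgeRepro2.T5InertStructureConstants Summit.Ventures.HodgeRepro2.T5InertTraceLift

section Printed

variable {R E : Type*} [CommRing R] [IsDomain R] [IsDiscreteValuationRing R] [Field E] [StarRing E]
  [Algebra R E] [IsFractionRing R E] [Finite (IsLocalRing.ResidueField R)]
  (hstar : ∀ x : E, IsLocalization.IsInteger R x → IsLocalization.IsInteger R (star x))
  (u : E) (hsu : star u = u) (hu0 : u ≠ 0) (hu : IsLocalization.IsInteger R u)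
  (hu' : IsLocalization.IsInteger R u⁻¹)
  {ϖ : R} (hϖ : Irreducible ϖ) (hs : star (algebraMap R E ϖ) = algebraMap R E ϖ)
  (htr : ∃ e : R, algebraMap R E e + star (algebraMap R E e) = 1)
  (hnt : ∃ x : R, ¬ IsLocalization.IsInteger R
    ((algebraMap R E x - star (algebraMap R E x)) * (algebraMap R E ϖ)⁻¹))

include hstar hsu hu0 hu hu' hϖ hs htr hnt in
/-- **`deg Tₙ = #(K aₙ K / K) = (q³ + 1) q^{4n−3}`** for `n ≥ 1`, `q = #{t ∈ 𝔽 : t + t̄ = 0}`. -/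
theorem ncard_orbit_cellU_eq_printed (n : ℕ) (hn : 1 ≤ n) :
    (MulAction.orbit (hyperspecialSubgroup R (J3 u))
        ((cellU hϖ hs u n : formUnitaryGroup (J3 u)) :
          formUnitaryGroup (J3 u) ⧸ hyperspecialSubgroup R (J3 u))).ncard =
      (Nat.card (traceZero R E) ^ 3 + 1) * Nat.card (traceZero R E) ^ (4 * n - 3) := by
  rw [ncard_orbit_cellU_eq hstar u hsu hu0 hu hu' hϖ hs htr n hn,
    card_residueField_eq_sq hstar hϖ hs htr (exists_residueStar_ne hstar hϖ hs hnt)]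
  obtain ⟨k, rfl⟩ : ∃ k, n = k + 1 := ⟨n - 1, by omega⟩
  rw [show k + 1 - 1 = k from rfl, show 4 * (k + 1) - 3 = 4 * k + 1 by omega]
  ring

include hstar hsu hu0 hu hu' hϖ hs htr hnt in
/-- `deg T₁ = q⁴ + q`. -/
theorem ncard_orbit_cellU_one_printed :
    (MulAction.orbit (hyperspecialSubgroup R (J3 u))
        ((cellU hϖ hs u 1 : formUnitaryGroup (J3 u)) :
          formUnitaryGroup (J3 u) ⧸ hyperspecialSubgroup R (J3 u))).ncard =
      Nat.card (traceZero R E) ^ 4 + Nat.card (traceZero R E) := by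
  rw [ncard_orbit_cellU_eq_printed hstar u hsu hu0 hu hu' hϖ hs htr hnt 1 le_rfl]
  ring

include hstar hsu hu0 hu hu' hϖ hs htr hnt in
/-- **`deg T_{n+1} = q⁴ · deg Tₙ`** for `n ≥ 1`. -/
theorem ncard_orbit_cellU_succ_printed (n : ℕ) (hn : 1 ≤ n) :
    (MulAction.orbit (hyperspecialSubgroup R (J3 u))
        ((cellU hϖ hs u (n + 1) : formUnitaryGroup (J3 u)) :
          formUnitaryGroup (J3 u) ⧸ hyperspecialSubgroup R (J3 u))).ncard =
      Nat.card (traceZero R E) ^ 4 *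
        (MulAction.orbit (hyperspecialSubgroup R (J3 u))
          ((cellU hϖ hs u n : formUnitaryGroup (J3 u)) :
            formUnitaryGroup (J3 u) ⧸ hyperspecialSubgroup R (J3 u))).ncard := by
  rw [ncard_orbit_cellU_succ hstar u hsu hu0 hu hu' hϖ hs htr n hn,
    card_residueField_eq_sq hstar hϖ hs htr (exists_residueStar_ne hstar hϖ hs hnt)]
  ring

omit [IsDomain R] [IsDiscreteValuationRing R] [Finite (IsLocalRing.ResidueField R)] in
include hϖ hs in
/-- The cell `a₀` is the identity. -/
theorem cellU_zero : cellU hϖ hs u 0 = 1 := by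
  apply Subtype.ext
  rw [coe_cellU, OneMemClass.coe_one]
  have h := cell_mul_cell (E := E) hϖ 0 0
  rw [Nat.add_zero] at h
  exact mul_left_cancel (h.trans (mul_one _).symm)

omit [IsDomain R] [IsDiscreteValuationRing R] [Finite (IsLocalRing.ResidueField R)] in
include hϖ hs in
/-- `deg T₀ = 1`. -/
theorem ncard_orbit_cellU_zero :
    (MulAction.orbit (hyperspecialSubgroup R (J3 u))
        ((cellU hϖ hs u 0 : formUnitaryGroup (J3 u)) :
          formUnitaryGroup (J3 u) ⧸ hyperspecialSubgroup R (J3 u))).ncard = 1 := by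
  rw [cellU_zero u hϖ hs]
  exact ncard_orbit_eq_one_of_mem_normalizer _ (Subgroup.one_mem _)

include hstar hsu hu0 hu hu' hϖ hs htr hnt in
/-- Every degree is positive. -/
theorem ncard_orbit_cellU_pos (n : ℕ) :
    0 < (MulAction.orbit (hyperspecialSubgroup R (J3 u))
        ((cellU hϖ hs u n : formUnitaryGroup (J3 u)) :
          formUnitaryGroup (J3 u) ⧸ hyperspecialSubgroup R (J3 u))).ncard := by
  rcases Nat.eq_zero_or_pos n with rfl | hn
  · rw [ncard_orbit_cellU_zero u hϖ hs]
    exact Nat.one_pos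
  · rw [ncard_orbit_cellU_eq_printed hstar u hsu hu0 hu hu' hϖ hs htr hnt n hn]
    have hq : 0 < Nat.card (traceZero R E) :=
      Nat.card_pos_iff.2 ⟨⟨⟨0, ⟨0, map_zero _, by rw [map_zero, star_zero, add_zero]⟩⟩⟩, inferInstance⟩
    positivity

/-! ## File 192's degree hypotheses, discharged -/

variable (k : Type*) [Field k] [CharZero k]

omit [CharZero k] in
include hstar hsu hu0 hu hu' hϖ hs htr hnt in
/-- `hdeg₁` of file 192: `(deg T₁ : k) = q⁴ + q`. -/
theorem hdeg₁_holds :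
    ((MulAction.orbit (hyperspecialSubgroup R (J3 u))
      ((cellU hϖ hs u 1 : formUnitaryGroup (J3 u)) :
        formUnitaryGroup (J3 u) ⧸ hyperspecialSubgroup R (J3 u))).ncard : k) =
      (Nat.card (traceZero R E) : k) ^ 4 + (Nat.card (traceZero R E) : k) := by
  rw [ncard_orbit_cellU_one_printed hstar u hsu hu0 hu hu' hϖ hs htr hnt]
  push_cast
  rfl

omit [CharZero k] in
include hstar hsu hu0 hu hu' hϖ hs htr hnt in
/-- `hdeg` of file 192: `(deg T_{n+1} : k) = q⁴ · (deg Tₙ : k)` for `n ≥ 1`. -/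
theorem hdeg_holds (n : ℕ) (hn : 1 ≤ n) :
    ((MulAction.orbit (hyperspecialSubgroup R (J3 u))
      ((cellU hϖ hs u (n + 1) : formUnitaryGroup (J3 u)) :
        formUnitaryGroup (J3 u) ⧸ hyperspecialSubgroup R (J3 u))).ncard : k) =
      (Nat.card (traceZero R E) : k) ^ 4 * ((MulAction.orbit (hyperspecialSubgroup R (J3 u))
        ((cellU hϖ hs u n : formUnitaryGroup (J3 u)) :
          formUnitaryGroup (J3 u) ⧸ hyperspecialSubgroup R (J3 u))).ncard : k) := by
  rw [ncard_orbit_cellU_succ_printed hstar u hsu hu0 hu hu' hϖ hs htr hnt n hn]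
  push_cast
  rfl

include hstar hsu hu0 hu hu' hϖ hs htr hnt in
/-- `hne` of file 192: `(deg Tₙ : k) ≠ 0` (characteristic `0`). -/
theorem hne_holds (n : ℕ) :
    ((MulAction.orbit (hyperspecialSubgroup R (J3 u))
      ((cellU hϖ hs u n : formUnitaryGroup (J3 u)) :
        formUnitaryGroup (J3 u) ⧸ hyperspecialSubgroup R (J3 u))).ncard : k) ≠ 0 :=
  Nat.cast_ne_zero.2 (ncard_orbit_cellU_pos hstar u hsu hu0 hu hu' hϖ hs htr hnt n).ne'

include hstar hsu hu0 hu hu' hϖ hs htr hnt in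
/-- **The tree recursion of `H(U(2,1), K)` WITHOUT degree hypotheses** (`n ≥ 1`, written with `n + 1`):
`T₁ · T_{n+1} = T_{n+2} + (q − 1) · T_{n+1} + q⁴ · Tₙ`, `q = (#{t ∈ 𝔽 : t + t̄ = 0} : k)`. -/
theorem mul_cellU_eq (n : ℕ) :
    heckeBasisCells hstar u hsu hu0 hu hu' hϖ hs k 1 *
        heckeBasisCells hstar u hsu hu0 hu hu' hϖ hs k (n + 1 + 1) =
      heckeBasisCells hstar u hsu hu0 hu hu' hϖ hs k (n + 1 + 1 + 1) +
        ((Nat.card (traceZero R E) : k) - 1) • heckeBasisCells hstar u hsu hu0 hu hu' hϖ hs k (n + 1 + 1) +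
        (Nat.card (traceZero R E) : k) ^ 4 • heckeBasisCells hstar u hsu hu0 hu hu' hϖ hs k (n + 1) :=
  mul_cellU_eq_of_degrees hstar u hsu hu0 hu hu' hϖ hs k (Nat.card (traceZero R E) : k)
    (hdeg₁_holds hstar u hsu hu0 hu hu' hϖ hs htr hnt k) (hdeg_holds hstar u hsu hu0 hu hu' hϖ hs htr hnt k)
    (hne_holds hstar u hsu hu0 hu hu' hϖ hs htr hnt k) n

include hstar hsu hu0 hu hu' hϖ hs htr hnt in
/-- **The tree recursion at `n = 0` WITHOUT degree hypotheses**: `T₁ · T₁ = T₂ + (q − 1) · T₁ + (q⁴ + q) · T₀`. -/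
theorem mul_cellU_one_eq :
    heckeBasisCells hstar u hsu hu0 hu hu' hϖ hs k 1 * heckeBasisCells hstar u hsu hu0 hu hu' hϖ hs k (0 + 1) =
      heckeBasisCells hstar u hsu hu0 hu hu' hϖ hs k (0 + 1 + 1) +
        ((Nat.card (traceZero R E) : k) - 1) • heckeBasisCells hstar u hsu hu0 hu hu' hϖ hs k (0 + 1) +
        ((Nat.card (traceZero R E) : k) ^ 4 + (Nat.card (traceZero R E) : k)) •
          heckeBasisCells hstar u hsu hu0 hu hu' hϖ hs k 0 :=
  mul_cellU_one_eq_of_degrees hstar u hsu hu0 hu hu' hϖ hs k (Nat.card (traceZero R E) : k)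
    (hdeg₁_holds hstar u hsu hu0 hu hu' hϖ hs htr hnt k) (hdeg_holds hstar u hsu hu0 hu hu' hϖ hs htr hnt k)
    (hne_holds hstar u hsu hu0 hu hu' hϖ hs htr hnt k)

end Printed

/-! ## From the non-triviality of the residue involution alone -/

section Inert

variable {R E : Type*} [CommRing R] [IsDomain R] [IsDiscreteValuationRing R] [Field E] [StarRing E]
  [Algebra R E] [IsFractionRing R E] [Finite (IsLocalRing.ResidueField R)]
  (hstar : ∀ x : E, IsLocalization.IsInteger R x → IsLocalization.IsInteger R (star x))
  (u : E) (hsu : star u = u) (hu0 : u ≠ 0) (hu : IsLocalization.IsInteger R u)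
  (hu' : IsLocalization.IsInteger R u⁻¹)
  {ϖ : R} (hϖ : Irreducible ϖ) (hs : star (algebraMap R E ϖ) = algebraMap R E ϖ)
  (hnt : ∃ x : R, ¬ IsLocalization.IsInteger R
    ((algebraMap R E x - star (algebraMap R E x)) * (algebraMap R E ϖ)⁻¹))

include hstar hsu hu0 hu hu' hϖ hs hnt in
/-- **`deg Tₙ = (q³ + 1) q^{4n−3}`** (`n ≥ 1`) from the non-triviality of the residue involution alone. -/
theorem ncard_orbit_cellU_eq_inert (n : ℕ) (hn : 1 ≤ n) :
    (MulAction.orbit (hyperspecialSubgroup R (J3 u))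
        ((cellU hϖ hs u n : formUnitaryGroup (J3 u)) :
          formUnitaryGroup (J3 u) ⧸ hyperspecialSubgroup R (J3 u))).ncard =
      (Nat.card (traceZero R E) ^ 3 + 1) * Nat.card (traceZero R E) ^ (4 * n - 3) :=
  ncard_orbit_cellU_eq_printed hstar u hsu hu0 hu hu' hϖ hs
    (exists_trace_lift hstar hϖ hs (exists_residueStar_ne hstar hϖ hs hnt)) hnt n hn

variable (k : Type*) [Field k] [CharZero k]

include hstar hsu hu0 hu hu' hϖ hs hnt in
/-- **The tree recursion** (`n ≥ 1`, written with `n + 1`) from the non-triviality of the residue involution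
alone. -/
theorem mul_cellU_eq_inert (n : ℕ) :
    heckeBasisCells hstar u hsu hu0 hu hu' hϖ hs k 1 *
        heckeBasisCells hstar u hsu hu0 hu hu' hϖ hs k (n + 1 + 1) =
      heckeBasisCells hstar u hsu hu0 hu hu' hϖ hs k (n + 1 + 1 + 1) +
        ((Nat.card (traceZero R E) : k) - 1) • heckeBasisCells hstar u hsu hu0 hu hu' hϖ hs k (n + 1 + 1) +
        (Nat.card (traceZero R E) : k) ^ 4 • heckeBasisCells hstar u hsu hu0 hu hu' hϖ hs k (n + 1) :=
  mul_cellU_eq hstar u hsu hu0 hu hu' hϖ hs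
    (exists_trace_lift hstar hϖ hs (exists_residueStar_ne hstar hϖ hs hnt)) hnt k n

include hstar hsu hu0 hu hu' hϖ hs hnt in
/-- **The tree recursion at `n = 0`** from the non-triviality of the residue involution alone. -/
theorem mul_cellU_one_eq_inert :
    heckeBasisCells hstar u hsu hu0 hu hu' hϖ hs k 1 * heckeBasisCells hstar u hsu hu0 hu hu' hϖ hs k (0 + 1) =
      heckeBasisCells hstar u hsu hu0 hu hu' hϖ hs k (0 + 1 + 1) +
        ((Nat.card (traceZero R E) : k) - 1) • heckeBasisCells hstar u hsu hu0 hu hu' hϖ hs k (0 + 1) +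
        ((Nat.card (traceZero R E) : k) ^ 4 + (Nat.card (traceZero R E) : k)) •
          heckeBasisCells hstar u hsu hu0 hu hu' hϖ hs k 0 :=
  mul_cellU_one_eq hstar u hsu hu0 hu hu' hϖ hs
    (exists_trace_lift hstar hϖ hs (exists_residueStar_ne hstar hϖ hs hnt)) hnt k

end Inert

end Summit.Ventures.HodgeRepro2.T5InertDegreePrinted
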